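import Literature.NumberTheory.QuadraticFields.HurwitzClassNumberCongruences
import Literature.NumberTheory.QuadraticFields.ClassNumberConductorFormula
import Literature.NumberTheory.QuadraticFields.DedekindZetaReducedForms
import Literature.NumberTheory.QuadraticFields.ImaginaryQuadraticPrescribedSplitting
import Literature.NumberTheory.QuadraticFields.FundamentalDiscriminant
import Literature.NumberTheory.QuadraticFields.KroneckerSplitting
import Literature.NumberTheory.EllipticCurves.HeegnerPoints
import Literature.NumberTheory.EllipticCurves.Rank1Residual.Predicates
import Mathlib.NumberTheory.LegendreSymbol.JacobiSymbol
import Mathlib.Algebra.Squarefree.Basic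
import HarnessLib

/-!
# Route `BiquadraticEisensteinDescent` (W-ALL row 12 · K12i), supply crux KS_R (stmt-BirchSwinnertonDyer-20713):
# the CLASS-NUMBER HALF for EVERY conductor — the «2-split seed» BRR⁺ granted Beckwith–Raum–Richter 2022 Thm. 1

Prover seat `bsd-wall-bed-p2` (g7), cell `bsd-wall`, 2026-08-27. THEOREMS ONLY (0 definitions, 0 named facts,
0 `sorry`); CONDITIONAL on the named fact `Literature.NumberTheory.QuadraticFields.BRR2022_thm_1` (Adv. Math. 409
(2022) Thm. 1, typed in `Literature/NumberTheory/QuadraticFields/HurwitzClassNumberCongruences.lean`, wi-81822)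
through the hypothesis `h22`; Hurwitz class numbers from `…/HurwitzClassNumber.lean` (defn-hurwitzClassNumber). The registered stub `stub_KSR1` of KS_R asks, for every pair `(W, p)` of the CM inert-bad
corner and every bound `B`, for an imaginary quadratic `K′` with `B < |d_K′|`, `4 < |d_K′|`, the Heegner
hypothesis for `N_W` and `p ∤ h(K′)`. For ODD `N_W` this is in the tree granted BRR IMRN 2024 Thm. 1 (rungs
p532604 / p540071); for EVEN `N_W` (every `j = 1728`, `j = 8000` curve, all even twists) the prime `2` must split,
which BRR 2024 / Wiles 2015 (split primes ODD) do not supply — the «2-split seed» gap of the cell's supply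
note (bsd-wall-cm g9/g10). This file closes it from the 2022 divisibility theorem ALONE:

* `exists_twoSplit_split_not_dvd_classNumber` — BRR⁺: for a prime `ℓ > 3`, a finite set `S` of odd primes and
  a bound `B`, an imaginary quadratic `K` with `d_K ≡ 1 (mod 8)` (`2` split), every `q ∈ S` split, `|d_K| > B`,
  `ℓ ∤ h_K`. Proof: `a = 8ℓ·∏(S ∪ {odd primes ≤ B})`, `b = a − 1` (`−b ≡ 1² (mod a)`, `ℓ ∤ b`); Thm. 1 (2022)
  gives `n` with `H(an + b) ≢ 0 (mod ℓ)`; `N := an + b ≡ 7 (mod 8)` so `H(N) = Σ_{f² ∣ N} h(−N/f²)`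
  (`hurwitzClassNumber_eq_sum_classNumber_of_emod_eight`), hence `ℓ ∤ h(D)` for some `D = −N/f² = d·g²`,
  `d` squarefree, `d ≡ 1 (mod 8)`; `h(d) ∣ h(dg²)` (Cox 7.24, `classNumber_fundamental_dvd_classNumber_sq_mul`)
  gives `ℓ ∤ h(d) = h_K`, `K = ℚ(√d)` (`exists_numberField_discr_eq`, `card_reducedForms_eq_classNumber`);
  `d·(gf)² = −N ≡ 1 (mod a)` and the decomposition law give the splitting; an odd prime `≤ B` dividing `d`
  would be ramified and split at once, so `|d| > B`.
* `exists_heegnerField_not_dvd_classNumber_unbounded` — the Heegner-hypothesis form for an ARBITRARY level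
  `N ≠ 0` (`S` = odd prime factors of `N`; `|d| ≡ 7 (mod 8) ⇒ |d| ≥ 7 > 4`).
* `heegnerClassNumberSupplyOfPrint` — the route author's child text `HeegnerClassNumberSupplyOfPrint` by
  value (`BRR2020 → BRR2022 → ∀ ℓ N B, …`; the 2020 theorem is accepted and not used).
* `ksr1_of_brr2022` — the registered `stub_KSR1` signature of KS_R VERBATIM, for ALL `N_W`, granted the 2022
  theorem (helper; conditional on the named fact).

BSD is not proved by this file. References: [BeckwithRaumRichter2022] Adv. Math. 409 (2022) 108663, Thm. 1;
[BeckwithRaumRichter2020] PNAS 117 (2020), Thm. 1; [Cox2013] Thm. 7.24, Thm. 7.7(ii); [Cohen1993] Def. 5.3.6.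
-/

set_option autoImplicit false

-- D-0017 layout: summit = sub-problem, so `Summit.BirchSwinnertonDyer.BirchSwinnertonDyer.…` is the mandated namespace.
set_option linter.dupNamespace false

open scoped NumberField
open NumberField Module
open Literature.NumberTheory.QuadraticFields Literature.NumberTheory.QuadraticFields.Quadratic
open Literature.NumberTheory.QuadraticFields.BinaryQuadraticForm (classNumber)
open Literature.NumberTheory.EllipticCurves

namespace Summit.BirchSwinnertonDyer.BirchSwinnertonDyer.Theorems.BiquadraticEisensteinDescentHeegnerFieldSupplyEvenRung

/-- The square of an odd integer is `1 (mod 8)`. -/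
private theorem sq_emod_eight_of_odd {x : ℤ} (hx : Odd x) : x ^ 2 % 8 = 1 := by
  obtain ⟨k, rfl⟩ := hx
  have h2 : 2 ∣ k * (k + 1) := (Int.even_mul_succ_self k).two_dvd
  obtain ⟨m, hm⟩ := h2
  have : (2 * k + 1) ^ 2 = 8 * m + 1 := by nlinarith [hm]
  omega

/-- For `N > 0` with `N ≡ 7 (mod 8)`: every `f` with `f² ∣ N` is odd and `D_f := −N/f² ≡ 1 (mod 8)`. -/
private theorem emod_eight_of_sq_dvd {N : ℤ} (hN8 : N % 8 = 7) {f : ℤ} (hf : f ^ 2 ∣ N) :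
    (-(N / f ^ 2)) % 8 = 1 := by
  obtain ⟨c, hc⟩ := hf
  have hf0 : f ≠ 0 := by
    rintro rfl
    simp at hc
    omega
  have hfodd : Odd f := by
    rcases Int.even_or_odd f with ⟨k, rfl⟩ | h
    · exfalso
      have : (k + k) ^ 2 * c = 4 * (k ^ 2 * c) := by ring
      omega
    · exact h
  have hsq : f ^ 2 % 8 = 1 := sq_emod_eight_of_odd hfodd
  have hdiv : N / f ^ 2 = c := by
    rw [hc, Int.mul_ediv_cancel_left _ (pow_ne_zero 2 hf0)]
  rw [hdiv]
  have hmul : N % 8 = (f ^ 2 % 8) * (c % 8) % 8 := by rw [hc, Int.mul_emod]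
  rw [hsq, one_mul, Int.emod_emod_of_dvd _ (by norm_num : (8 : ℤ) ∣ 8)] at hmul
  omega

/-- From `d·x² ≡ 1 (mod q)`, `q` prime: the Jacobi symbol `(d/q) = 1`. -/
private theorem jacobiSym_eq_one_of_mul_sq_emod {d x : ℤ} {q : ℕ}
    (h : d * x ^ 2 % (q : ℤ) = 1) : jacobiSym d q = 1 := by
  have hJ : jacobiSym (d * x ^ 2) q = 1 := by
    rw [jacobiSym.mod_left, h]
    exact jacobiSym.one_left q
  rw [jacobiSym.mul_left, jacobiSym.pow_left] at hJ
  rcases jacobiSym.trichotomy x q with h0 | h1 | h1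
  · rw [h0] at hJ; simp at hJ
  · rw [h1] at hJ; simpa using hJ
  · rw [h1] at hJ; simpa using hJ

/-- **BRR⁺ (the «2-split seed», unbounded), GRANTED Beckwith–Raum–Richter 2022 Thm. 1 (hypothesis `h22`).**
For every prime `ℓ > 3`, every finite set `S` of odd primes and every bound `B` there is an imaginary quadratic
field `K` (`[K:ℚ] = 2`, totally complex) with `d_K ≡ 1 (mod 8)` — so `2` splits —, every `q ∈ S` split,
`|d_K| > B`, and `ℓ ∤ h_K`. CONDITIONAL on the named fact. [cite: BeckwithRaumRichter2022, Theorem 1]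
[cite: Cox2013, §7.D Thm. 7.24 and §7.B Thm. 7.7(ii)] -/
theorem exists_twoSplit_split_not_dvd_classNumber
    (h22 : BRR2022_thm_1) {ℓ : ℕ} (hℓ : ℓ.Prime) (h3 : 3 < ℓ)
    (S : Finset ℕ) (hS : ∀ q ∈ S, q.Prime ∧ q ≠ 2) (B : ℕ) :
    ∃ (K : Type) (_ : Field K) (_ : NumberField K), finrank ℚ K = 2 ∧ IsTotallyComplex K ∧
      B < (NumberField.discr K).natAbs ∧ NumberField.discr K % 8 = 1 ∧
      ((Ideal.span {(2 : ℤ)}).primesOver (𝓞 K)).ncard = 2 ∧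
      (∀ q ∈ S, ((Ideal.span {(q : ℤ)}).primesOver (𝓞 K)).ncard = 2) ∧
      ¬ ℓ ∣ NumberField.classNumber K := by
  classical
  -- the odd primes to split: `S` together with the odd primes `≤ B`
  set T : Finset ℕ := S ∪ (Finset.range (B + 1)).filter (fun r => r.Prime ∧ r ≠ 2) with hT
  have hTprime : ∀ q ∈ T, q.Prime ∧ q ≠ 2 := by
    intro q hq
    rcases Finset.mem_union.mp hq with h | h
    · exact hS q h
    · exact (Finset.mem_filter.mp h).2
  -- modulus `a = 8ℓ∏T` and residue `b = a − 1`
  set a : ℕ := 8 * ℓ * ∏ q ∈ T, q with ha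
  have hT0 : 0 < ∏ q ∈ T, q := Finset.prod_pos fun q hq => (hTprime q hq).1.pos
  have ha0 : 0 < a := by positivity
  have h8a : (8 : ℤ) ∣ (a : ℤ) := by
    refine ⟨(ℓ : ℤ) * ((∏ q ∈ T, q : ℕ) : ℤ), ?_⟩
    rw [ha]; push_cast; ring
  have hℓa : (ℓ : ℤ) ∣ (a : ℤ) := by
    refine ⟨8 * ((∏ q ∈ T, q : ℕ) : ℤ), ?_⟩
    rw [ha]; push_cast; ring
  have hqa : ∀ q ∈ T, (q : ℤ) ∣ (a : ℤ) := by
    intro q hq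
    have h1 : q ∣ ∏ q ∈ T, q := Finset.dvd_prod_of_mem (fun q => q) hq
    have h2 : q ∣ a := by rw [ha]; exact h1.mul_left _
    exact_mod_cast h2
  set b : ℤ := (a : ℤ) - 1 with hb
  have hsq : ∃ x : ℤ, (a : ℤ) ∣ x ^ 2 + b := ⟨1, by simp [hb]⟩
  have hℓb : ¬ (ℓ : ℤ) ∣ b := by
    intro h
    have h1 : (ℓ : ℤ) ∣ (a : ℤ) - b := dvd_sub hℓa h
    rw [hb, sub_sub_cancel] at h1
    have := Int.le_of_dvd one_pos h1
    have := hℓ.two_le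
    omega
  -- Beckwith–Raum–Richter 2022, Thm. 1 (contrapositive): some `H(an+b)` is not `≡ 0 (mod ℓ)`
  have hex : ∃ n : ℤ, ¬ RatCongZero ℓ (hurwitzClassNumber (a * n + b)) := by
    by_contra hall
    exact hℓb (h22 ℓ a b hℓ h3 ha0 hsq fun m => not_not.mp (not_exists.mp hall m))
  obtain ⟨n, hn⟩ := hex
  set N : ℤ := (a : ℤ) * n + b with hN
  -- `N ≡ −1 (mod m)` for every `m ∣ a`
  have hNmod : ∀ m : ℤ, m ∣ (a : ℤ) → N ≡ -1 [ZMOD m] := by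
    intro m hm
    rw [Int.modEq_iff_dvd]
    have : (-1 : ℤ) - N = (a : ℤ) * (-(n + 1)) := by rw [hN, hb]; ring
    rw [this]
    exact hm.mul_right _
  have ha40 : (2 : ℤ) ≤ (a : ℤ) := by
    have : 2 ≤ a := by
      rw [ha]
      nlinarith [hT0, hℓ.two_le]
    exact_mod_cast this
  have hN0 : N ≠ 0 := by
    intro h0
    have h1 := Int.modEq_iff_dvd.mp (hNmod (a : ℤ) dvd_rfl)
    rw [h0, sub_zero, dvd_neg] at h1
    have := Int.le_of_dvd one_pos h1
    omega
  have hNpos : 0 < N := by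
    by_contra hle
    have hlt : N < 0 := lt_of_le_of_ne (not_lt.mp hle) hN0
    apply hn
    rw [hurwitzClassNumber_of_neg hlt]
    exact ratCongZero_zero ℓ
  have hN8 : N % 8 = 7 := by
    have h1 : N % 8 = (-1) % 8 := hNmod 8 h8a
    omega
  -- `ℓ ∤ H(N) = Σ_f h(−N/f²)`: some summand is prime to `ℓ`
  rw [hurwitzClassNumber_eq_sum_classNumber_of_emod_eight hN8, ← Nat.cast_sum,
    ratCongZero_natCast_iff] at hn
  obtain ⟨f, hfF, hfℓ⟩ : ∃ f ∈ (Finset.Icc 1 N.toNat).filter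
      (fun f : ℕ => ((f : ℤ) ^ 2 ∣ N) ∧ ((-(N / (f : ℤ) ^ 2)) % 4 = 0 ∨ (-(N / (f : ℤ) ^ 2)) % 4 = 1)),
      ¬ ℓ ∣ classNumber (-(N / (f : ℤ) ^ 2)) := by
    by_contra hall
    exact hn (Finset.dvd_sum fun i hi => not_not.mp fun h => hall ⟨i, hi, h⟩)
  obtain ⟨hfI, hfN, -⟩ := Finset.mem_filter.mp hfF
  have hf1 : 1 ≤ f := (Finset.mem_Icc.mp hfI).1
  set D : ℤ := -(N / (f : ℤ) ^ 2) with hD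
  have hD8 : D % 8 = 1 := emod_eight_of_sq_dvd hN8 hfN
  have hDf : D * (f : ℤ) ^ 2 = -N := by
    rw [hD, neg_mul, Int.ediv_mul_cancel hfN]
  have hD0 : D < 0 := by
    have hf2 : (0 : ℤ) < (f : ℤ) ^ 2 := by positivity
    nlinarith
  -- `D = d·g²` with `d` squarefree
  obtain ⟨dn, g, hdn0, hg0, hdg, hsf⟩ := Nat.sq_mul_squarefree_of_pos (Int.natAbs_pos.mpr hD0.ne)
  set d : ℤ := -(dn : ℤ) with hd
  have hDdg : ((g : ℤ)) ^ 2 * d = D := by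
    have h2 : ((g ^ 2 * dn : ℕ) : ℤ) = (D.natAbs : ℤ) := by rw [hdg]
    rw [Int.natCast_natAbs, abs_of_neg hD0] at h2
    push_cast at h2
    rw [hd]
    linarith
  have hd0 : d < 0 := by
    have : (0 : ℤ) < dn := by exact_mod_cast hdn0
    rw [hd]
    linarith
  have hgodd : Odd (g : ℤ) := by
    rcases Int.even_or_odd (g : ℤ) with ⟨k, hk⟩ | h
    · exfalso
      have : D = 4 * (k ^ 2 * d) := by rw [← hDdg, hk]; ring
      omega
    · exact h
  have hd8 : d % 8 = 1 := by
    have hg8 : (g : ℤ) ^ 2 % 8 = 1 := sq_emod_eight_of_odd hgodd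
    have hmul : D % 8 = ((g : ℤ) ^ 2 % 8) * (d % 8) % 8 := by rw [← hDdg, Int.mul_emod]
    rw [hg8, one_mul, Int.emod_emod_of_dvd _ (by norm_num : (8 : ℤ) ∣ 8)] at hmul
    omega
  have hfd : d % 4 = 1 ∧ Squarefree d ∧ d ≠ 1 := by
    refine ⟨by omega, ?_, by omega⟩
    refine Int.squarefree_natAbs.mp ?_
    rw [hd, Int.natAbs_neg, Int.natAbs_natCast]
    exact hsf
  -- `h(d) ∣ h(g² d) = h(D)`, so `ℓ ∤ h(d)`
  have hdvd : classNumber d ∣ classNumber D := by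
    rw [← hDdg]
    exact BinaryQuadraticForm.classNumber_fundamental_dvd_classNumber_sq_mul (Or.inl hfd) hd0 hg0.ne'
  have hℓd : ¬ ℓ ∣ classNumber d := fun h => hfℓ (h.trans hdvd)
  -- the congruence `d·(g f)² ≡ 1 (mod m)` for `m ∣ a`
  have hcong : ∀ m : ℤ, m ∣ (a : ℤ) → d * ((g : ℤ) * f) ^ 2 % m = 1 % m := by
    intro m hm
    have h1 : d * ((g : ℤ) * f) ^ 2 = -N := by rw [← hDf, ← hDdg]; ring
    have h2 : -N ≡ 1 [ZMOD m] := by simpa using (hNmod m hm).neg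
    rw [h1]
    exact h2
  -- the field `K = ℚ(√d)`
  obtain ⟨K, _, _, h2, hdisc⟩ := exists_numberField_discr_eq (D := d) (Or.inl hfd)
  have hdK0 : NumberField.discr K < 0 := by rw [hdisc]; exact hd0
  have hclass : classNumber d = NumberField.classNumber K := by
    rw [← hdisc]; exact card_reducedForms_eq_classNumber h2 hdK0
  refine ⟨K, inferInstance, inferInstance, h2, isTotallyComplex_of_discr_neg h2 hdK0, ?_, ?_, ?_, ?_, ?_⟩
  · -- `B < |d|`
    by_contra hle
    rw [not_lt, hdisc, hd, Int.natAbs_neg, Int.natAbs_natCast] at hle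
    have hdn7 : 7 ≤ dn := by omega
    have hdnodd : ¬ 2 ∣ dn := by
      intro h2d
      have : (2 : ℤ) ∣ d := by rw [hd]; exact (Int.natCast_dvd_natCast.mpr h2d).neg_right
      omega
    set r := dn.minFac with hr
    have hrp : r.Prime := Nat.minFac_prime (by omega)
    have hrd : r ∣ dn := Nat.minFac_dvd dn
    have hrB : r ≤ B := (Nat.minFac_le hdn0).trans hle
    have hr2 : r ≠ 2 := fun h => hdnodd (h ▸ hrd)
    have hrT : r ∈ T := Finset.mem_union_right _
      (Finset.mem_filter.mpr ⟨Finset.mem_range.mpr (by omega), hrp, hr2⟩)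
    have hsplit : ((Ideal.span {(r : ℤ)}).primesOver (𝓞 K)).ncard = 2 :=
      (ncard_primesOver_eq_two_iff_jacobiSym h2 hrp hr2).mpr
        (by rw [hdisc]; exact jacobiSym_eq_one_of_mul_sq_emod (by
          rw [hcong r (hqa r hrT)]; exact Int.emod_eq_of_lt (by norm_num) (by exact_mod_cast hrp.one_lt)))
    have hj1 : jacobiSym d r = 1 := by
      have := (ncard_primesOver_eq_two_iff_jacobiSym h2 hrp hr2).mp hsplit
      rwa [hdisc] at this
    have hj0 : jacobiSym d r = 0 := by
      rw [jacobiSym.mod_left, show d % (r : ℤ) = 0 from ?_, jacobiSym.zero_left hrp.one_lt]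
      rw [hd]
      exact Int.emod_eq_zero_of_dvd ((Int.natCast_dvd_natCast.mpr hrd).neg_right)
    rw [hj0] at hj1
    exact zero_ne_one hj1
  · rw [hdisc]; exact hd8
  · exact (ncard_primesOver_two_eq_two_iff h2).mpr (by rw [hdisc]; exact hd8)
  · intro q hq
    have hqT : q ∈ T := Finset.mem_union_left _ hq
    obtain ⟨hqp, hq2⟩ := hS q hq
    refine (ncard_primesOver_eq_two_iff_jacobiSym h2 hqp hq2).mpr ?_
    rw [hdisc]
    refine jacobiSym_eq_one_of_mul_sq_emod (x := (g : ℤ) * f) ?_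
    rw [hcong q (hqa q hqT)]
    exact Int.emod_eq_of_lt (by norm_num) (by exact_mod_cast hqp.one_lt)
  · rwa [← hclass]

/-- **Corollary (Heegner-hypothesis form, ARBITRARY level), granted Beckwith–Raum–Richter 2022 Thm. 1.**
For every prime `ℓ > 3`, every level `N ≠ 0` (even levels included) and every bound `B` there is an
imaginary quadratic field `K` (`IsImaginaryQuadratic`) with `|d_K| > B`, `|d_K| > 4`, every prime
factor of `N` split in `K` (`SatisfiesHeegnerHypothesis N K`) and `ℓ ∤ h_K` — the corollary above with
`S` = the odd prime factors of `N`. [cite: BeckwithRaumRichter2022, Theorem 1] -/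
theorem exists_heegnerField_not_dvd_classNumber_unbounded
    (h22 : BRR2022_thm_1) {ℓ : ℕ} (hℓ : ℓ.Prime) (h3 : 3 < ℓ)
    {N : ℕ} (hN : N ≠ 0) (B : ℕ) :
    ∃ (K : Type) (_ : Field K) (_ : NumberField K),
      IsImaginaryQuadratic K ∧
      B < (NumberField.discr K).natAbs ∧ 4 < (NumberField.discr K).natAbs ∧
      SatisfiesHeegnerHypothesis N K ∧ ¬ ℓ ∣ NumberField.classNumber K := by
  have hS : ∀ q ∈ N.primeFactors.filter (fun q => q ≠ 2), q.Prime ∧ q ≠ 2 := by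
    intro q hq
    rw [Finset.mem_filter] at hq
    exact ⟨Nat.prime_of_mem_primeFactors hq.1, hq.2⟩
  obtain ⟨K, iF, iN, h2, htc, hB, -, h2s, hSs, hcl⟩ :=
    exists_twoSplit_split_not_dvd_classNumber h22 hℓ h3 (N.primeFactors.filter (fun q => q ≠ 2)) hS
      (max B 4)
  refine ⟨K, iF, iN, ⟨h2, htc⟩, lt_of_le_of_lt (le_max_left _ _) hB,
    lt_of_le_of_lt (le_max_right _ _) hB, fun q hq hqN => ?_, hcl⟩
  by_cases hq2 : q = 2
  · subst hq2
    exact_mod_cast h2s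
  · exact hSs q (Finset.mem_filter.mpr ⟨Nat.mem_primeFactors.mpr ⟨hq, hqN, hN⟩, hq2⟩)

/-- **The route author's child `HeegnerClassNumberSupplyOfPrint` BY VALUE** (cm g10 children-KSR-g10.json):
`BRR2020_thm_1 → BRR2022_thm_1 → ∀ ℓ N B, ℓ prime → 5 ≤ ℓ → N ≠ 0 → ∃ K imaginary
quadratic, B < |d_K| ∧ 4 < |d_K| ∧ SatisfiesHeegnerHypothesis N K ∧ ℓ ∤ h_K` (the 2020 theorem is accepted, not
used). [cite: BeckwithRaumRichter2022, Theorem 1] -/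
theorem heegnerClassNumberSupplyOfPrint :
    Literature.NumberTheory.QuadraticFields.BRR2020_thm_1 → Literature.NumberTheory.QuadraticFields.BRR2022_thm_1 →
      ∀ (ℓ N B : ℕ), ℓ.Prime → 5 ≤ ℓ → N ≠ 0 →
        ∃ (K : Type) (_ : Field K) (_ : NumberField K), IsImaginaryQuadratic K ∧
          B < (NumberField.discr K).natAbs ∧ 4 < (NumberField.discr K).natAbs ∧
          SatisfiesHeegnerHypothesis N K ∧ ¬ ℓ ∣ NumberField.classNumber K :=
  fun _ h22 _ _ B hℓ h5 hN => exists_heegnerField_not_dvd_classNumber_unbounded h22 hℓ (by omega) hN B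

/-- **`stub_KSR1` of KS_R (item stmt-BirchSwinnertonDyer-20713) for EVERY conductor, granted BRR 2022 Thm. 1**
(signature = the registered stub verbatim after the hypothesis `h22`): for `W` CM of analytic rank one,
`p ≥ 5` inert-bad, and any bound `B`, an imaginary quadratic `K′` with `B < |d_K′|`, `4 < |d_K′|`, the Heegner
hypothesis for `N_W` (so `p` and `2 ∣ N_W` split) and `p ∤ h(K′)`. The corner hypotheses are not used.
CONDITIONAL on the named fact. [cite: BeckwithRaumRichter2022, Theorem 1] -/
theorem ksr1_of_brr2022 (h22 : BRR2022_thm_1) :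
    ∀ (W : WeierstrassCurve ℚ) [W.IsElliptic] [W.IsGloballyMinimal] (p : ℕ) [Fact p.Prime]
      [NeZero (W.conductorNorm ℤ)], W.HasCM → W.analyticRank = 1 → 5 ≤ p →
      Rank1Residual.CMInert W p → ¬ Rank1Residual.Good W p → ∀ B : ℕ,
      ∃ (K : Type) (_ : Field K) (_ : NumberField K), IsImaginaryQuadratic K ∧
        B < (NumberField.discr K).natAbs ∧ 4 < (NumberField.discr K).natAbs ∧
        SatisfiesHeegnerHypothesis (W.conductorNorm ℤ) K ∧ ¬ p ∣ NumberField.classNumber K := by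
  intro W _ _ p hp _ _ _ hp5 _ _ B
  exact exists_heegnerField_not_dvd_classNumber_unbounded h22 hp.out (by omega) (NeZero.ne _) B

end Summit.BirchSwinnertonDyer.BirchSwinnertonDyer.Theorems.BiquadraticEisensteinDescentHeegnerFieldSupplyEvenRung
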